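import Summits.ResolutionOfSingularities.ResolutionOfSingularities.Theorems.HilbertSamuelEliminationSigmaMaxModificationsCorridor3WLadderIsoProximityDefs
import Summits.ResolutionOfSingularities.ResolutionOfSingularities.Theorems.HilbertSamuelEliminationSigmaMaxModificationsCorridor3OriginAscent
import HarnessLib

/-!
# [OURS · L1 W4.2 · D14 · H∞-c] Dropping the first `a` floors of an isolated point tower: tails start at stage `0`

Sub-problem `ResolutionOfSingularities`, crux `SigmaMaxModifications` / conjunct `SigmaMaxModificationsCorridor3`
(route `HilbertSamuelElimination`, line `w_ladder`), idea chain L1 C5 «K1 FREE-RATIONAL TAILS».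

K1 (`IdeasL1C5.IsoFreeRationalTailsImpossible`) refutes an isolated E3 point tower `(T, pt)` over a maximal origin that is
free-rational FROM SOME STAGE `n₀` ON.  Every assembly of the arc contradiction (ROUTE H: `…IsoTailsFormalFrameAssemblyStep`
/ `exists_frameTower_arc`; ROUTE G alike) is written for a tail starting at stage `0`.  This file supplies the reduction:
the dropped tower `T.drop a` (Literature `BlowupTower.drop`: `X_n := X_{a+n}`) with the marked points `n ↦ pt (a + n)` is again an
isolated E3 point tower (`IsIsoPointTower.drop`), its stage `0` is again a maximal origin for the same `(p, N, ν)`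
(`IsIsoPointTower.isMaximalOrigin_drop`, from `IdeasL1Idea2R4.IsIsoPointTower.isMaximalOrigin`), the step predicates commute
with the shift (`isRationalStep_drop_iff`, `isSatelliteStep_drop_iff`), hence

* `isoFreeRationalTailsImpossible_of_forall_zero` — **K1 follows from its stage-`0` form** «no isolated E3 point tower over a
  maximal origin is free-rational from the start»;
* `IsoFreeRationalTailsImpossible.iff_forall_zero` — and is equivalent to it.

Everything here is OURS bookkeeping on tree definitions; no statement of the manuscript under adjudication and no published
theorem is asserted. [cite: CossartJannsenSaito2020, Def. 6.39 (towers read from a later stage)]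
-/

set_option linter.dupNamespace false -- mandated namespace of this single-conjunct summit
open CategoryTheory AlgebraicGeometry TopologicalSpace
open Summit.ResolutionOfSingularities.ResolutionOfSingularities.Theorems.CampaignW42
open Literature.AlgebraicGeometry.Resolution Literature.AlgebraicGeometry.CossartJannsenSaito2020

universe u

namespace Summit.ResolutionOfSingularities.ResolutionOfSingularities.Cruxes.SigmaMaxModifications.IdeasL1Idea2R4

/-- [OURS · L1 W4.2] Dropping the first `a` floors of an isolated E3 point tower gives an isolated E3 point tower (all six clauses
are clauses of the original tower at stage `a + n`). [cite: CossartJannsenSaito2020, Def. 6.39] -/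
theorem IsIsoPointTower.drop {N : ℕ} {ν : ℕ → ℕ} {T : BlowupTower.{u}} {pt : ∀ n, T.X n} (hT : IsIsoPointTower N ν T pt)
    (a : ℕ) : IsIsoPointTower N ν (T.drop a) (fun n => pt (a + n)) :=
  ⟨fun n => hT.1 (a + n), fun n => hT.2.1 (a + n), fun n => hT.2.2.1 (a + n), fun n => hT.2.2.2.1 (a + n),
    fun n => hT.2.2.2.2.1 (a + n), fun n => hT.2.2.2.2.2 (a + n)⟩

/-- [OURS · L1 W4.2] Stage `0` of the dropped tower is a maximal origin for the same `(p, N, ν)` (every stage of an isolated E3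
point tower over a maximal origin is one, `IsIsoPointTower.isMaximalOrigin`). [cite: CossartJannsenSaito2020, Cor. 3.12] -/
theorem IsIsoPointTower.isMaximalOrigin_drop {p N : ℕ} {ν : ℕ → ℕ} {T : BlowupTower.{u}} {pt : ∀ n, T.X n}
    (hT : IsIsoPointTower N ν T pt) (h0 : IsMaximalOrigin p N ν (T.X 0) (pt 0)) (a : ℕ) :
    IsMaximalOrigin p N ν ((T.drop a).X 0) ((fun n => pt (a + n)) 0) :=
  hT.isMaximalOrigin h0 a

end Summit.ResolutionOfSingularities.ResolutionOfSingularities.Cruxes.SigmaMaxModifications.IdeasL1Idea2R4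

namespace Summit.ResolutionOfSingularities.ResolutionOfSingularities.Cruxes.SigmaMaxModifications.IdeasL1C5

open Summit.ResolutionOfSingularities.ResolutionOfSingularities.Cruxes.SigmaMaxModifications.IdeasL1Idea2R4

/-- [OURS · L1 W4.2] The RATIONAL-step predicate commutes with dropping floors. [folklore] -/
theorem isRationalStep_drop_iff (T : BlowupTower.{u}) (pt : ∀ n, T.X n) (a n : ℕ) :
    IsRationalStep (T.drop a) (fun n => pt (a + n)) n ↔ IsRationalStep T pt (a + n) :=
  Iff.rfl

/-- [OURS · L1 W4.2] The SATELLITE-step predicate commutes with dropping floors. [folklore] -/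
theorem isSatelliteStep_drop_iff (T : BlowupTower.{u}) (pt : ∀ n, T.X n) (a n : ℕ) :
    IsSatelliteStep (T.drop a) (fun n => pt (a + n)) n ↔ IsSatelliteStep T pt (a + n) :=
  Iff.rfl

/-- [OURS · L1 W4.2] A free-rational tail from stage `a` on is a free-rational tower from stage `0` on after dropping `a` floors.
[folklore] -/
theorem forall_freeRational_drop {T : BlowupTower.{u}} {pt : ∀ n, T.X n} {a : ℕ}
    (h : ∀ n, a ≤ n → IsRationalStep T pt n ∧ ¬ IsSatelliteStep T pt n) (n : ℕ) :
    IsRationalStep (T.drop a) (fun n => pt (a + n)) n ∧ ¬ IsSatelliteStep (T.drop a) (fun n => pt (a + n)) n :=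
  h (a + n) (Nat.le_add_right a n)

/-- [OURS · L1 W4.2] **K1 follows from its stage-`0` form**: if no isolated E3 point tower over a maximal origin of characteristic
`p` at level `N` is free-rational from stage `0` on, then none is eventually free-rational (drop the first `n₀` floors).
[cite: CossartJannsenSaito2020, Def. 6.39] -/
theorem isoFreeRationalTailsImpossible_of_forall_zero {p N : ℕ}
    (H : ∀ (ν : ℕ → ℕ) (T : BlowupTower.{u}) (pt : ∀ n, T.X n), IsMaximalOrigin p N ν (T.X 0) (pt 0) →
      IsIsoPointTower N ν T pt → ¬ ∀ n, IsRationalStep T pt n ∧ ¬ IsSatelliteStep T pt n) :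
    IsoFreeRationalTailsImpossible.{u} p N := by
  intro ν T pt h0 hT ⟨n₀, hn₀⟩
  exact H ν (T.drop n₀) (fun n => pt (n₀ + n)) (hT.isMaximalOrigin_drop h0 n₀) (hT.drop n₀)
    (forall_freeRational_drop hn₀)

/-- [OURS · L1 W4.2] … and conversely (take `n₀ = 0`), so K1 is EQUIVALENT to its stage-`0` form. [folklore] -/
theorem IsoFreeRationalTailsImpossible.iff_forall_zero {p N : ℕ} :
    IsoFreeRationalTailsImpossible.{u} p N ↔
      ∀ (ν : ℕ → ℕ) (T : BlowupTower.{u}) (pt : ∀ n, T.X n), IsMaximalOrigin p N ν (T.X 0) (pt 0) →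
        IsIsoPointTower N ν T pt → ¬ ∀ n, IsRationalStep T pt n ∧ ¬ IsSatelliteStep T pt n := by
  refine ⟨fun H ν T pt h0 hT hall => H ν T pt h0 hT ⟨0, fun n _ => hall n⟩, isoFreeRationalTailsImpossible_of_forall_zero⟩

end Summit.ResolutionOfSingularities.ResolutionOfSingularities.Cruxes.SigmaMaxModifications.IdeasL1C5
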